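import Summits.ValiantsHypothesis.ValiantsHypothesis.Theses.TwoAdicLadder

/-!
# Route TwoAdicLadder — `Assembly` (stmt-ValiantsHypothesis-5953)

`PrecisionLadder → TwoIntegralNormalisation → ValiantsHypothesis`, by the route's deciding theorem
`closes` (which takes the two hypotheses in the other order); candidate proof on file since 2026-08-15,
landed under Theorems (prover-only). Honest framing: bookkeeping only.
-/

set_option linter.dupNamespace false

namespace Summit.ValiantsHypothesis.ValiantsHypothesis.Theorems.TwoAdicLadder

open Summit.ValiantsHypothesis.ValiantsHypothesis.Theses.TwoAdicLadder

/-- **Item `Assembly` (stmt-ValiantsHypothesis-5953), PROVED** by `closes`. [folklore] -/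
theorem assembly_proof : Assembly :=
  fun hP hT => closes hT hP

end Summit.ValiantsHypothesis.ValiantsHypothesis.Theorems.TwoAdicLadder
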